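import Summits.PneNP.PneNP.Theorems.OneSliceConstantBandSliceLemma23
import Summits.PneNP.PneNP.Theorems.OneSliceConstantBandTransferStep

/-!
# Route OneSlice, crux `ConstantBand` (stmt-PneNP-2834), line `flat-prior-relative-minterms`:
# the crux from the line's TRANSFER TARGET alone — `BandPair → ConstantBand`

The line reduces the crux `Summit.PneNP.PneNP.Theses.OneSlice.ConstantBand` to one open engine, recorded in the
tree in three successively STRONGER forms, each closing the crux through landed theorems only:

* `BandPair` (the transfer target C⁺: "for every `c` there are `k ≥ 3`, a width `w` and `γ > 0` such that,
  eventually, every size-`n^c` monotone circuit rejecting at most a `γ`-fraction of the planted pairs `x ∪ K_A`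
  from the critical lower band accepts more than half of the band") — THIS file:
  `fprm_constantBand_of_bandPair : BandPair → ConstantBand`, through `stub_transferStep` (S5, landed) and
  `stub_sliceLemma23` (S1, landed) and nothing else;
* `AdvSparse → ConstantBand` (`OneSliceConstantBandOfAdvSparse.lean`, via `fprm_bandPair_of_advSparse`);
* `RelMintermSparse → ConstantBand` (`OneSliceConstantBandOfEngine.lean`, via all four landed stubs).

`BandPair` is the WEAKEST statement in the tree whose proof closes the crux by a one-line application, hence the
natural shape in which to promote the line's residual stub (lead c1, 2026-08-16: `stub_relMintermSparse` is
crux-sized — it implies the crux, which implies Rossman's open single-threshold problem via route item 2839 — and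
every one-law census proof of it is capped at a fixed polynomial by the crux's two negative notes). CONDITIONAL in
the sense of D-0014 (hypothesis = an open statement of the line, not a Literature fact); it closes nothing by itself.
-/

set_option linter.dupNamespace false

namespace Summit.PneNP.PneNP.Cruxes.ConstantBand.FlatPriorRelativeMinterms

open Summit.PneNP.PneNP.Theses.OneSlice (ConstantBand)

/-- **The crux from the transfer target.** `BandPair → ConstantBand`, through the landed transfer
`stub_transferStep : SliceLemma23 → BandPair → ConstantBandSchedule`, the landed slice Lemma 23
`stub_sliceLemma23`, and the disprover's `Iff.rfl` bridge `constantBand_iff`. CONDITIONAL on the open `BandPair`. -/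
theorem fprm_constantBand_of_bandPair : BandPair → ConstantBand :=
  fun hB => constantBand_iff.2 (stub_transferStep stub_sliceLemma23 hB)

end Summit.PneNP.PneNP.Cruxes.ConstantBand.FlatPriorRelativeMinterms
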